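import Summits.Ventures.PercRepro.Night2LocalD2R14SixOneB
import Summits.Ventures.PercRepro.Night2LocalD2R14LargeFour

/-!
# PercRepro — the six-element columns of R1₄ with one far preimage, part C: the pair part (night-2, gen 16)

At a six-element shadow set `S` with a far preimage `B₀` (pair set `X₀`; proofs/NIGHT-2-k1.md §7.0 (U2)), every
other pair preimage `B` has `T_B = B ∩ B₀` of three elements (`y` and two points of `B₀ ∖ {y}`), and
`cl B ∩ cl B₀ ⊆ cl T_B` (`clF_inter_subset_clF_inter_of_far`), so `|G ∖ cl B| ≥ |G ∖ S| − |(G ∖ S) ∩ cl T_B| + 2`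
(`card_sdiff_clF_add_card_inter_ge`).  The three possible `T_B` have pairwise disjoint traces `(G ∖ S) ∩ cl T` on
`G ∖ S` (`disjoint_trace_of_ne`: `cl T ∩ cl T' ⊆ cl {w, y}` meets `G ∖ {y}` only in `w ∈ S`), so with `|G ∖ S| ≥ 3` at
most one `T` has a trace of `≥ |G ∖ S| − 1` points, i.e. at most two non-far pair preimages have `|G ∖ cl B| = 3`:

**`sum_r14Pair_le_of_far`**: `Σ_{pairPre} r14Pair ≤ 7/25 + 2·(2/25) + 4·(2/75) = 41/75` when `3 ≤ |G ∖ S|`.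
-/

namespace PercRepro.Shadow

open Finset PerFlat ThmH

variable {α : Type*} [DecidableEq α] {M : Matroid α} [M.Finite]

/-- `r14Pair ≤ 2/75` for `|G ∖ cl B| ≥ 4`. -/
theorem r14Pair_le_of_four_le {G B : Finset α} (hm : 4 ≤ (G \ clF M B).card) : r14Pair M G B ≤ 2 / 75 := by
  unfold r14Pair
  split_ifs with h
  · have h4 : (G \ clF M B).card = 4 := by omega
    rw [h4]
    norm_num [Nat.choose]
  · norm_num

open scoped Classical in
/-- A far preimage has four elements. -/
theorem card_eq_four_of_mem_opFarPre {G S B₀ : Finset α} (h₀ : B₀ ∈ opFarPre M G S) (h6 : S.card = 6) :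
    B₀.card = 4 := by
  have hc₀ : (S \ B₀).card = 2 := by
    rw [sdiff_eq_of_mem_opFarPre h₀]; exact (mem_opFarPre.1 h₀).2.1
  have := Finset.card_sdiff_add_card_eq_card (subset_of_mem_opFarPre h₀)
  omega

open scoped Classical in
/-- For a pair preimage `B ≠ B₀` at `|S| = 6`: `B ∩ B₀` has three elements and contains `y`. -/
theorem card_inter_far_eq_three {G : Finset α} (hG : G ∈ flatsQ M (4 + 1)) (hd : (gr M \ G).card = 2) {y : α}
    (hyG : y ∈ G) (hyc : y ∉ clF M (G.erase y)) {S B₀ : Finset α} (h₀ : B₀ ∈ opFarPre M G S) (h6 : S.card = 6)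
    {B : Finset α} (hB : B ∈ pairPre M 4 G S) (hne : B ≠ B₀) : (B ∩ B₀).card = 3 ∧ y ∈ B ∩ B₀ := by
  have hp₀ : B₀ ∈ pairPre M 4 G S := opFarPre_subset_pairPre G S h₀
  have hBS := subset_of_mem_pairPre hB
  have hB₀S := subset_of_mem_pairPre hp₀
  refine ⟨?_, Finset.mem_inter.2 ⟨mem_of_mem_pairPre hG hyG hyc hB, mem_of_mem_opFarPre hG hyG hyc h₀⟩⟩
  -- `B ∩ B₀ = S ∖ (X ∪ X₀)` with `|X ∪ X₀| = 3`
  have hXne := sdiff_ne_of_mem_pairPre hB hp₀ hne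
  obtain ⟨e, heX, hecl⟩ := Finset.not_subset.1 (not_sdiff_subset_clF_of_far hG hd hyG hyc h₀ hB)
  have he₀ : e ∈ S \ B₀ := Finset.mem_sdiff.2 ⟨(Finset.mem_sdiff.1 heX).1,
    fun h => hecl (subset_clF (mem_membersIn.1 (mem_opFarPre.1 h₀).1).1 h)⟩
  have hc := card_sdiff_of_mem_pairPre hB
  have hc₀ := card_sdiff_of_mem_pairPre hp₀
  have hu := Finset.card_union_add_card_inter (S \ B) (S \ B₀)
  have hi : ((S \ B) ∩ (S \ B₀)).card = 1 := by
    have hpos : 0 < ((S \ B) ∩ (S \ B₀)).card := Finset.card_pos.2 ⟨e, Finset.mem_inter.2 ⟨heX, he₀⟩⟩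
    have hle : ((S \ B) ∩ (S \ B₀)).card ≤ 1 := by
      by_contra h
      push Not at h
      have h1 : (S \ B) ∩ (S \ B₀) = S \ B :=
        Finset.eq_of_subset_of_card_le Finset.inter_subset_left (by omega)
      have h2 : (S \ B) ∩ (S \ B₀) = S \ B₀ :=
        Finset.eq_of_subset_of_card_le Finset.inter_subset_right (by omega)
      exact hXne (h1.symm.trans h2)
    omega
  have heq : B ∩ B₀ = S \ ((S \ B) ∪ (S \ B₀)) := by
    ext t
    rw [Finset.mem_inter, Finset.mem_sdiff, Finset.mem_union, Finset.mem_sdiff, Finset.mem_sdiff]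
    constructor
    · rintro ⟨htB, htB₀⟩
      exact ⟨hBS htB, by tauto⟩
    · rintro ⟨htS, h⟩
      push Not at h
      exact ⟨h.1 htS, h.2 htS⟩
  rw [heq]
  have h1 := Finset.card_sdiff_add_card_inter S ((S \ B) ∪ (S \ B₀))
  have h2 : S ∩ ((S \ B) ∪ (S \ B₀)) = (S \ B) ∪ (S \ B₀) :=
    Finset.inter_eq_right.2 (Finset.union_subset Finset.sdiff_subset Finset.sdiff_subset)
  rw [h2] at h1
  omega

open scoped Classical in
/-- `cl B ∩ cl B₀ ⊆ cl (B ∩ B₀)` for a pair preimage `B ≠ B₀` at `|S| = 6` (simple matroid). -/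
theorem clF_inter_subset_clF_inter_of_far {G : Finset α} (hG : G ∈ flatsQ M (4 + 1)) (hd : (gr M \ G).card = 2)
    (hsimple : ∀ e ∈ gr M, ∀ f ∈ gr M, e ≠ f → rkN M {e, f} = 2) {y : α} (hyG : y ∈ G)
    (hyc : y ∉ clF M (G.erase y)) {S B₀ : Finset α} (hS : S ∈ shadowAt M (4 + 2) 4 (Uq M (4 + 2) 4) G)
    (h₀ : B₀ ∈ opFarPre M G S) (h6 : S.card = 6) {B : Finset α} (hB : B ∈ pairPre M 4 G S) (hne : B ≠ B₀) :
    clF M B ∩ clF M B₀ ⊆ clF M (B ∩ B₀) := by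
  have hGg : G ⊆ gr M := (mem_flatsQ.1 hG).1
  have hSG : S ⊆ G := subset_of_mem_shadowAt hS
  obtain ⟨hc3, hy⟩ := card_inter_far_eq_three hG hd hyG hyc h₀ h6 hB hne
  have hr : 3 ≤ rkN M (B ∩ B₀) := by
    have hRe : (B ∩ B₀).erase y ⊆ G.erase y :=
      Finset.erase_subset_erase _ (Finset.inter_subset_left.trans ((subset_of_mem_pairPre hB).trans hSG))
    have hc : 2 ≤ ((B ∩ B₀).erase y).card := by rw [Finset.card_erase_of_mem hy, hc3]
    have := three_le_rkN_insert_of_two_le_card hGg hyG hyc hsimple hRe hc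
    rw [Finset.insert_erase hy] at this
    exact this
  exact clF_inter_subset_clF_of_three_le hG hB (opFarPre_subset_pairPre G S h₀) hne Finset.inter_subset_left
    Finset.inter_subset_right hr

open scoped Classical in
/-- `|G ∖ cl B| + |(G ∖ S) ∩ cl (B ∩ B₀)| ≥ |G ∖ S| + 2` for a pair preimage `B ≠ B₀`. -/
theorem card_sdiff_clF_add_card_inter_ge {G : Finset α} (hG : G ∈ flatsQ M (4 + 1)) (hd : (gr M \ G).card = 2)
    (hsimple : ∀ e ∈ gr M, ∀ f ∈ gr M, e ≠ f → rkN M {e, f} = 2) {y : α} (hyG : y ∈ G)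
    (hyc : y ∉ clF M (G.erase y)) {S B₀ : Finset α} (hS : S ∈ shadowAt M (4 + 2) 4 (Uq M (4 + 2) 4) G)
    (h₀ : B₀ ∈ opFarPre M G S) (h6 : S.card = 6) {B : Finset α} (hB : B ∈ pairPre M 4 G S) (hne : B ≠ B₀) :
    (G \ S).card + 2 ≤ (G \ clF M B).card + ((G \ S) ∩ clF M (B ∩ B₀)).card := by
  have hSG : S ⊆ G := subset_of_mem_shadowAt hS
  have hsub := clF_inter_subset_clF_inter_of_far hG hd hsimple hyG hyc hS h₀ h6 hB hne
  have hGS := sdiff_subset_clF_of_mem_opFarPre h₀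
  -- `((G ∖ S) ∖ cl (B ∩ B₀)) ∪ (S ∖ B) ⊆ G ∖ cl B`, disjointly
  have h1 : ((G \ S) \ clF M (B ∩ B₀)) ∪ (S \ B) ⊆ G \ clF M B := by
    intro t ht
    rw [Finset.mem_union] at ht
    rcases ht with ht | ht
    · rw [Finset.mem_sdiff, Finset.mem_sdiff] at ht
      rw [Finset.mem_sdiff]
      refine ⟨ht.1.1, fun h => ht.2 (hsub (Finset.mem_inter.2 ⟨h, hGS (Finset.mem_sdiff.2 ht.1)⟩))⟩
    · exact sdiff_subset_of_mem_pairPre hB ht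
  have hdisj : Disjoint ((G \ S) \ clF M (B ∩ B₀)) (S \ B) := by
    rw [Finset.disjoint_left]
    intro t ht ht'
    exact (Finset.mem_sdiff.1 (Finset.mem_sdiff.1 ht).1).2 (Finset.mem_sdiff.1 ht').1
  have h2 := Finset.card_le_card h1
  rw [Finset.card_union_of_disjoint hdisj, card_sdiff_of_mem_pairPre hB] at h2
  have h3 := Finset.card_sdiff_add_card_inter (G \ S) (clF M (B ∩ B₀))
  omega

open scoped Classical in
/-- Two distinct three-subsets `T ≠ T'` of the far preimage `B₀`, both containing `y`, have traces
`(G ∖ S) ∩ cl T`, `(G ∖ S) ∩ cl T'` that are disjoint (simple matroid). -/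
theorem disjoint_trace_of_ne {G : Finset α} (hG : G ∈ flatsQ M (4 + 1))
    (hsimple : ∀ e ∈ gr M, ∀ f ∈ gr M, e ≠ f → rkN M {e, f} = 2) {y : α} (hyG : y ∈ G)
    (hyc : y ∉ clF M (G.erase y)) {S B₀ : Finset α} (hS : S ∈ shadowAt M (4 + 2) 4 (Uq M (4 + 2) 4) G)
    (h₀ : B₀ ∈ opFarPre M G S) (h6 : S.card = 6) {T T' : Finset α} (hT : T ⊆ B₀) (hT' : T' ⊆ B₀)
    (hTc : T.card = 3) (hT'c : T'.card = 3) (hyT : y ∈ T) (hyT' : y ∈ T') (hne : T ≠ T') :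
    Disjoint ((G \ S) ∩ clF M T) ((G \ S) ∩ clF M T') := by
  have hGg : G ⊆ gr M := (mem_flatsQ.1 hG).1
  have hSG : S ⊆ G := subset_of_mem_shadowAt hS
  have hB₀S := subset_of_mem_opFarPre h₀
  have hU₀ : B₀ ∈ Uq M (4 + 2) 4 := (mem_membersIn.1 (mem_opFarPre.1 h₀).1).1
  have hB₀4 := card_eq_four_of_mem_opFarPre h₀ h6
  have hB₀g : B₀ ⊆ gr M := hB₀S.trans (hSG.trans hGg)
  -- `|T ∩ T'| = 2`
  have hi : (T ∩ T').card = 2 := by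
    have hu := Finset.card_union_add_card_inter T T'
    have hle := Finset.card_le_card (Finset.union_subset hT hT')
    have : (T ∩ T').card ≤ 2 := by
      by_contra h
      push Not at h
      have h1 : T ∩ T' = T := Finset.eq_of_subset_of_card_le Finset.inter_subset_left (by omega)
      have h2 : T ∩ T' = T' := Finset.eq_of_subset_of_card_le Finset.inter_subset_right (by omega)
      exact hne (h1.symm.trans h2)
    omega
  have hyI : y ∈ T ∩ T' := Finset.mem_inter.2 ⟨hyT, hyT'⟩
  obtain ⟨w, hw⟩ : ((T ∩ T').erase y).Nonempty := by
    apply Finset.card_pos.1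
    rw [Finset.card_erase_of_mem hyI, hi]
    norm_num
  rw [Finset.mem_erase] at hw
  have hwS : w ∈ S := hB₀S (hT (Finset.mem_inter.1 hw.2).1)
  -- the ranks: `ρ(T) = ρ(T') = 3`, `ρ(cl T ∩ cl T') ≤ 2`
  have hrT : 3 ≤ rkN M T := by
    have hRe : T.erase y ⊆ G.erase y := Finset.erase_subset_erase _ (hT.trans (hB₀S.trans hSG))
    have hc : 2 ≤ (T.erase y).card := by rw [Finset.card_erase_of_mem hyT, hTc]
    have := three_le_rkN_insert_of_two_le_card hGg hyG hyc hsimple hRe hc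
    rw [Finset.insert_erase hyT] at this
    exact this
  have hrT' : 3 ≤ rkN M T' := by
    have hRe : T'.erase y ⊆ G.erase y := Finset.erase_subset_erase _ (hT'.trans (hB₀S.trans hSG))
    have hc : 2 ≤ (T'.erase y).card := by rw [Finset.card_erase_of_mem hyT', hT'c]
    have := three_le_rkN_insert_of_two_le_card hGg hyG hyc hsimple hRe hc
    rw [Finset.insert_erase hyT'] at this
    exact this
  have hrT3 : rkN M T ≤ 3 := by
    have := rkN_le_card_fin (M := M) T
    omega
  have hrT'3 : rkN M T' ≤ 3 := by
    have := rkN_le_card_fin (M := M) T'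
    omega
  have hclT : rkN M (clF M T) = 3 := by
    have h1 : rkN M (clF M T) ≤ rkN M T := rkN_le_of_subset_clF' (M := M) (le_refl _)
    have h2 := rkN_mono (M := M) (subset_clF_of_subset_gr (hT.trans hB₀g))
    omega
  have hclT' : rkN M (clF M T') = 3 := by
    have h1 : rkN M (clF M T') ≤ rkN M T' := rkN_le_of_subset_clF' (M := M) (le_refl _)
    have h2 := rkN_mono (M := M) (subset_clF_of_subset_gr (hT'.trans hB₀g))
    omega
  have hunion : 4 ≤ rkN M (clF M T ∪ clF M T') := by
    have h1 : B₀ ⊆ clF M T ∪ clF M T' := by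
      intro t ht
      rw [Finset.mem_union]
      -- `B₀ = T ∪ T'` since `|T ∪ T'| = 4 = |B₀|`
      have hu := Finset.card_union_add_card_inter T T'
      have heq : T ∪ T' = B₀ := Finset.eq_of_subset_of_card_le (Finset.union_subset hT hT') (by omega)
      have : t ∈ T ∪ T' := by rw [heq]; exact ht
      rcases Finset.mem_union.1 this with h | h
      · exact Or.inl (subset_clF_of_subset_gr (hT.trans hB₀g) h)
      · exact Or.inr (subset_clF_of_subset_gr (hT'.trans hB₀g) h)
    have := rkN_mono (M := M) h1
    rw [rkN_eq_of_mem_Uq hU₀] at this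
    exact this
  have hinter : rkN M (clF M T ∩ clF M T') ≤ 2 := by
    have := rkN_submod (M := M) (clF M T) (clF M T')
    omega
  -- `cl T ∩ cl T' ⊆ cl {w, y}` (rank `2`, containing the rank-`2` set `{w, y}`)
  have hwy : rkN M ({w, y} : Finset α) = 2 := by
    have h := rkN_insert_coloop_eq hGg hyG hyc (Finset.singleton_subset_iff.2
      (Finset.mem_erase.2 ⟨hw.1, hSG hwS⟩) : ({w} : Finset α) ⊆ G.erase y)
    have h1 : rkN M ({w} : Finset α) = 1 := by
      have h2 := rkN_le_card_fin (M := M) {w}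
      rw [Finset.card_singleton] at h2
      have h3 : 2 ≤ rkN M ({w, y} : Finset α) :=
        two_le_rkN_of_two_le_card hsimple (by
          intro t ht
          rw [Finset.mem_insert, Finset.mem_singleton] at ht
          rcases ht with rfl | rfl
          · exact hSG hwS |> hGg
          · exact hGg hyG) (by rw [Finset.card_pair hw.1])
      have h4 : insert y ({w} : Finset α) = {w, y} := by rw [Finset.pair_comm]
      rw [h4] at h
      omega
    have h4 : insert y ({w} : Finset α) = {w, y} := by rw [Finset.pair_comm]
    rw [h4] at h
    omega
  have hwyI : ({w, y} : Finset α) ⊆ clF M T ∩ clF M T' := by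
    intro t ht
    rw [Finset.mem_insert, Finset.mem_singleton] at ht
    rw [Finset.mem_inter]
    rcases ht with rfl | rfl
    · exact ⟨subset_clF_of_subset_gr (hT.trans hB₀g) (Finset.mem_inter.1 hw.2).1,
        subset_clF_of_subset_gr (hT'.trans hB₀g) (Finset.mem_inter.1 hw.2).2⟩
    · exact ⟨subset_clF_of_subset_gr (hT.trans hB₀g) hyT, subset_clF_of_subset_gr (hT'.trans hB₀g) hyT'⟩
  have hIg : clF M T ∩ clF M T' ⊆ gr M :=
    Finset.inter_subset_left.trans ((clF_mono hT).trans ((mem_membersIn.1 (mem_opFarPre.1 h₀).1).2.trans hGg))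
  have hIsub : clF M T ∩ clF M T' ⊆ clF M {w, y} := by
    have hge := rkN_mono (M := M) hwyI
    have heq : rkN M ({w, y} : Finset α) = rkN M (clF M T ∩ clF M T') := by omega
    have := subset_closure_of_rkN_eq (M := M) hIg hwyI heq
    intro t ht
    rw [mem_clF_iff]
    exact this (Finset.mem_coe.2 ht)
  -- a point of `G ∖ S` in `cl {w, y}` would equal `w`
  rw [Finset.disjoint_left]
  intro g hg hg'
  rw [Finset.mem_inter, Finset.mem_sdiff] at hg hg'
  have hgI : g ∈ clF M ({w, y} : Finset α) := hIsub (Finset.mem_inter.2 ⟨hg.2, hg'.2⟩)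
  have hyS : y ∈ S := mem_of_mem_shadowAt_of_coloop (by rw [rkN_erase_eq_of_coloop hG hyG hyc]) hS
  have hgy : g ≠ y := fun h => hg.1.2 (h ▸ hyS)
  have h4 : ({w, y} : Finset α) = insert y {w} := by rw [Finset.pair_comm]
  rw [h4] at hgI
  have hgw : g ∈ clF M ({w} : Finset α) :=
    mem_clF_of_mem_clF_insert_coloop hyc (Finset.singleton_subset_iff.2 (Finset.mem_erase.2 ⟨hw.1, hSG hwS⟩))
      (Finset.mem_erase.2 ⟨hgy, hg.1.1⟩) hgI
  have hr1 : rkN M ({g, w} : Finset α) ≤ 1 := by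
    have h1 : ({g, w} : Finset α) ⊆ clF M {w} :=
      Finset.insert_subset hgw (Finset.singleton_subset_iff.2 (subset_clF_of_subset_gr
        (Finset.singleton_subset_iff.2 (hGg (hSG hwS))) (Finset.mem_singleton_self _)))
    have h2 := rkN_le_of_subset_clF' (M := M) h1
    have h3 := rkN_le_card_fin (M := M) {w}
    rw [Finset.card_singleton] at h3
    omega
  have hgw' : g ≠ w := fun h => hg.1.2 (h ▸ hwS)
  have := hsimple g (hGg hg.1.1) w (hGg (hSG hwS)) hgw'
  omega

end PercRepro.Shadow
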